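import Mathlib
import HarnessLib
import Summits.HubbardSuperconductivity.HubbardSuperconductivity.Theorems.KLProgrammeKLRegimeEnginePairTransferOutClassBars
import Summits.HubbardSuperconductivity.HubbardSuperconductivity.Theorems.KLProgrammeKLRegimeSplitGeoShellLogPP

/-!
# Route `KLProgramme` — ENGINE item stmt-HubbardSuperconductivity-20437 `KLRegimeEngineV17F2`, stub (c) value lane, located item «(c)-OUT-UNSMEAR» / «XS-PP-MASS»:
# the CROSS-SCALE mass of the pinned transfer weight at a FROZEN total momentum — `Σ_p |tₙ[φ](Qm,p)| ≤ A·(klRelGain n ρ + 2⁻ⁿ)`, `ρ = |p_Qm|_𝕋 ≥ Λₙ`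
# (cell gate-hubbard-kl, seat hubbard-kl-k3c2-p2 g19; memo HOME/hubbard-kl-k3c2-p2/OUT-OF-CLASS-E2.md §8–§9a; plan g23 (R237))

WHY.  `klTransferWeight … n φ Qm p` is the `p`-slice of the MIXED particle–particle bubble at total momentum `Qm`: hard line `w^K_{Λₙ}·ĝ_K` (every shell above `Λₙ`)
against the soft line `φ·ĝ_K` (…Export2).  Its mass `Σ_p |t|` is flat (`≤ 2¹⁶`, `sum_abs_klTransferWeight_le_of_frameOK`) — enough IN class, where the pp channel is
resummed.  OUT of class (`|p_Qm|_𝕋 = ρ ≫ Λₙ`) the un-smearing step (iii) of the (E2″-F) increment reads this mass UN-resummed (`member(n,n+1) − plain(n) =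
plain(n)·(N_t − 1) + defect`, `‖N_t − 1‖ ≲ m·Σ|t|`), so its PROFILE in `ρ` is what books it: one two-shell unit `≍ Λₙ/ρ` per hard shell `Λ_j ≤ ρ` (the shell count
`kₙ(ρ) = klShellCount n ρ`), a geometric tail `Λₙ/Λ_j` over the shells above `ρ`, the caustic `√Λ_j` terms summing to `√Λₙ ∝ 2⁻ⁿ`, and the flat top/UV part `∝ Λₙ`:
the shape `klRelGain n ρ + 2⁻ⁿ` of the pp shell-log addend (`GeoConsts.addShellLogPP`, …SplitGeoShellLogPP; token candidate `klEngGeo12`, …DefsG12).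
* §1 `klDyadicEnv`, `hardLine_le_klDyadicEnv` — the hard line at momentum `q` is under the dyadic envelope `Σ_{j≤n} (4/Λ_j)·𝟙[|e_K(q)| ≤ Λ_j] + 32` of `min(2/Λₙ, 1/|e_K(q)|)`;
* §2 `softSum_filter_le_linear` — the soft phase-space sum RESTRICTED to a momentum set with a linear level count `c₁ηL² + c₂L` is `≤ (7c₁+4c₂)·Λ·βL²`
  (Literature `sum_one_sub_cutoff_div_sqrt_le_linear` run on the dispersion frozen to `Λ` off the set);
* §3 `card_twoShell_filter_le_linear` — the lattice two-shell count (`card_twoShell_mul_sq_le_klTS`, gen 16) in that linear form, per hard shell `j`;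
* §4 (generic reshaping) `sum_abs_klTransferWeight_le_env` (both rungs under the envelope), `sum_indicator_slice_le_softSum`, `sum_klDyadicEnv_mul_eq`;
* §5 (companion file …CrossScaleMassBound) **`sum_abs_klTransferWeight_le_shellLog`** — for `FrameOK R U N μ K`, `R.WF2`, `0 < U ≤ klTSU R`, `μ ∈ klWindowC`, `klBetaMin ≤ β ≤ L`, `n ≤ nScales β`,
  `8Gβ ≤ L` (`G = 4 + (8/3)Gfr₁U²`), a soft fraction `0 ≤ φ ≤ 1 − w^K_{Λₙ}` and a total momentum with `Λₙ ≤ ρ = |p_Qm|_𝕋`: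
  `Σ_p |tₙ[φ](Qm,p)| ≤ (90·(7/(4π²) + 2G/π)·klTS + 2¹⁸)·(klRelGain n ρ + 2⁻ⁿ)`.
Exact arithmetic over landed lemmas; nothing about the model's SIZES beyond the landed two-shell package is asserted; nothing asserts (E2″-F), (c), K3 or
superconductivity.  0 kit · 0 lit.
-/

noncomputable section

namespace Summit.HubbardSuperconductivity.HubbardSuperconductivity.Theorems.KLRegimeSplit

set_option linter.dupNamespace false -- summit = problem name (single-conjunct summit), D-0017

open Real Finset Complex Literature.MathematicalPhysics.QuantumLattice Literature.Probability.LatticeModels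
open Summit.HubbardSuperconductivity.HubbardSuperconductivity.Theorems.KLProgrammeLegKernels
open Summit.HubbardSuperconductivity.HubbardSuperconductivity.Theorems.TwoPointAssembly
open Summit.HubbardSuperconductivity.HubbardSuperconductivity.Theorems.DispersionFlow
open Summit.HubbardSuperconductivity.HubbardSuperconductivity.Theorems.EngineV8

/-! ## §1 The dyadic envelope of the hard line -/

/-- **The dyadic envelope** at scale `n` of a band level `e`: `Σ_{j ≤ n} (4/Λ_j)·𝟙[|e| ≤ Λ_j] + 32` (`32 = 1/klE0`). -/
def klDyadicEnv (n : ℕ) (e : ℝ) : ℝ :=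
  ∑ j ∈ range (n + 1), (4 / klScale klE0 j) * (if |e| ≤ klScale klE0 j then 1 else 0) + 32

/-- `0 ≤ klDyadicEnv n e`. -/
theorem klDyadicEnv_nonneg (n : ℕ) (e : ℝ) : 0 ≤ klDyadicEnv n e := by
  unfold klDyadicEnv
  refine add_nonneg (sum_nonneg fun j _ => ?_) (by norm_num)
  have := klth_klScale_pos j
  split_ifs <;> positivity

/-- **The envelope dominates `min(2/Λₙ, 1/|e|)`**: if `h ≤ 2/Λₙ` and `h·|e| ≤ 1` then `h ≤ klDyadicEnv n e`. -/
theorem le_klDyadicEnv_of_le {n : ℕ} {e h : ℝ} (h2 : h ≤ 2 / klScale klE0 n) (he : h * |e| ≤ 1) : h ≤ klDyadicEnv n e := by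
  have hΛ : ∀ j, 0 < klScale klE0 j := klth_klScale_pos
  have hterm0 : ∀ j ∈ range (n + 1), 0 ≤ (4 / klScale klE0 j) * (if |e| ≤ klScale klE0 j then (1 : ℝ) else 0) := fun j _ => by
    have := hΛ j; split_ifs <;> positivity
  have hS0 : 0 ≤ ∑ j ∈ range (n + 1), (4 / klScale klE0 j) * (if |e| ≤ klScale klE0 j then (1 : ℝ) else 0) := sum_nonneg hterm0
  unfold klDyadicEnv
  by_cases hn : |e| ≤ klScale klE0 n
  · -- the `j = n` term already gives `4/Λₙ ≥ 2/Λₙ ≥ h`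
    have hmem : n ∈ range (n + 1) := by simp
    have hsingle := single_le_sum hterm0 hmem
    rw [if_pos hn, mul_one] at hsingle
    have : 2 / klScale klE0 n ≤ 4 / klScale klE0 n := div_le_div_of_nonneg_right (by norm_num) (hΛ n).le
    linarith
  · push Not at hn
    have he0 : 0 < |e| := (hΛ n).trans hn
    have hinv : h ≤ 1 / |e| := by rw [le_div_iff₀ he0]; exact he
    by_cases htop : klScale klE0 0 < |e|
    · -- UV: `1/|e| < 1/Λ₀ = 32`
      have h32 : 1 / |e| ≤ 32 := by
        rw [klScale_klE0_zero] at htop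
        have : (1 : ℝ) / |e| ≤ 1 / klE0 := one_div_le_one_div_of_le (by unfold klE0; norm_num) htop.le
        have e32 : (1 : ℝ) / klE0 = 32 := by unfold klE0; norm_num
        linarith [e32]
      linarith
    · push Not at htop
      -- locate the last shell `i ≤ n` with `|e| ≤ Λ_i`; then `i < n` and `Λ_{i+1} < |e|`
      set i := Nat.findGreatest (fun j => |e| ≤ klScale klE0 j) n with hi
      have hPi : |e| ≤ klScale klE0 i := Nat.findGreatest_spec (P := fun j => |e| ≤ klScale klE0 j) (Nat.zero_le n) htop
      have hin : i ≤ n := Nat.findGreatest_le n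
      have hne : i ≠ n := by intro h'; rw [h'] at hPi; linarith
      have hlt : i < n := lt_of_le_of_ne hin hne
      have hnot : ¬ |e| ≤ klScale klE0 (i + 1) :=
        Nat.findGreatest_is_greatest (P := fun j => |e| ≤ klScale klE0 j) (Nat.lt_succ_self i) (by omega)
      push Not at hnot
      have hsucc : klScale klE0 (i + 1) = klScale klE0 i / 4 := klth_klScale_succ i
      have h4 : 1 / |e| ≤ 4 / klScale klE0 i := by
        rw [div_le_div_iff₀ he0 (hΛ i)]
        rw [hsucc] at hnot
        linarith
      have hmem : i ∈ range (n + 1) := by simp; omega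
      have hsingle := single_le_sum hterm0 hmem
      rw [if_pos hPi, mul_one] at hsingle
      linarith

section Lines

variable {L M : ℕ} [NeZero L] (β μ : ℝ) (K : TrigPolyC4v)

omit [NeZero L] in
/-- **The hard line under the envelope**: `w^K_{Λₙ}(k)·‖ĝ_K(k)‖ ≤ klDyadicEnv n (e_K(k⃗))`. -/
theorem hardLine_le_klDyadicEnv (n : ℕ) (k : FreqMomentum L M) :
    hubbardCutoffWeightCT L M β μ K (klScale klE0 n) k * ‖propCT L M β μ K k‖ ≤ klDyadicEnv n (nambuXiCT L μ K k.2) := by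
  have hΛ : 0 < klScale klE0 n := klth_klScale_pos n
  have hw := salmhoferCutoff_mem_Icc ((matsubaraFreq β M k.1 ^ 2 + nambuXiCT L μ K k.2 ^ 2) / klScale klE0 n ^ 2)
  refine le_klDyadicEnv_of_le (hubbardCutoffWeightCT_mul_norm_propCT_le β μ K hΛ k) ?_
  -- `w·‖ĝ‖·|e| ≤ ‖ĝ‖·|e| = |e|/√(ω²+e²) ≤ 1`
  have hg : ‖propCT L M β μ K k‖ * |nambuXiCT L μ K k.2| ≤ 1 := by
    rw [norm_propCT_eq]
    set e := nambuXiCT L μ K k.2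
    set r := Real.sqrt (matsubaraFreq β M k.1 ^ 2 + e ^ 2) with hr
    have hre : |e| ≤ r := by
      rw [hr, ← Real.sqrt_sq_eq_abs]
      exact Real.sqrt_le_sqrt (by nlinarith [sq_nonneg (matsubaraFreq β M k.1)])
    rcases (abs_nonneg e).eq_or_lt with h0e | hpos
    · rw [← h0e, mul_zero]; norm_num
    · have hr0 : 0 < r := hpos.trans_le hre
      rw [inv_mul_le_iff₀ hr0]
      simpa using hre
  calc hubbardCutoffWeightCT L M β μ K (klScale klE0 n) k * ‖propCT L M β μ K k‖ * |nambuXiCT L μ K k.2|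
      ≤ 1 * ‖propCT L M β μ K k‖ * |nambuXiCT L μ K k.2| := by gcongr; exact hw.2
    _ ≤ 1 := by rw [one_mul]; exact hg

end Lines

/-! ## §2 The soft phase-space sum restricted to a momentum set with a linear level count -/

section SoftRestricted

variable {L M : ℕ} [NeZero L] {β : ℝ} (μ : ℝ) (K : TrigPolyC4v)

/-- **Restricted soft sum**: for a momentum predicate `P` with `#{p : P p ∧ |e_K(p)| < η} ≤ c₁ηL² + c₂L` (`0 < η ≤ Λ`), `0 < β ≤ L`, `π/β ≤ Λ`:
`Σ_{(i,p) : P p} (1 − w^K_Λ(i,p))/√(ω_i² + e_K(p)²) ≤ (7c₁ + 4c₂)·Λ·βL²` — the Literature lemma run on the dispersion frozen to `Λ` off `P` (there the summand vanishes). -/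
theorem softSum_filter_le_linear (hβ : 0 < β) {Λ c₁ c₂ : ℝ} (hΛ : 0 < Λ) (hΛβ : Real.pi / β ≤ Λ) (hβL : β ≤ L) (hc₁ : 0 ≤ c₁) (hc₂ : 0 ≤ c₂)
    (P : TorusSite 2 L → Prop) [DecidablePred P]
    (hcount : ∀ η : ℝ, 0 < η → η ≤ Λ →
      (((univ : Finset (TorusSite 2 L)).filter fun p => P p ∧ |nambuXiCT L μ K p| < η).card : ℝ) ≤ c₁ * η * (L : ℝ) ^ 2 + c₂ * L) :
    ∑ k ∈ (univ : Finset (FreqMomentum L M)).filter (fun k => P k.2),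
        (1 - hubbardCutoffWeightCT L M β μ K Λ k) / Real.sqrt (matsubaraFreq β M k.1 ^ 2 + nambuXiCT L μ K k.2 ^ 2) ≤
      (7 * c₁ + 4 * c₂) * Λ * β * (L : ℝ) ^ 2 := by
  classical
  -- the frozen dispersion
  set e' : TorusSite 2 L → ℝ := fun p => if P p then nambuXiCT L μ K p else Λ with he'
  have hoff : ∀ k : FreqMomentum L M, ¬ P k.2 →
      (1 - salmhoferCutoff ((matsubaraFreq β M k.1 ^ 2 + e' k.2 ^ 2) / Λ ^ 2)) / Real.sqrt (matsubaraFreq β M k.1 ^ 2 + e' k.2 ^ 2) = 0 := by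
    intro k hk
    have hek : e' k.2 = Λ := by simp [he', hk]
    rw [hek]
    have h1 : 1 ≤ (matsubaraFreq β M k.1 ^ 2 + Λ ^ 2) / Λ ^ 2 := by
      rw [le_div_iff₀ (by positivity)]; nlinarith [sq_nonneg (matsubaraFreq β M k.1)]
    rw [salmhoferCutoff_of_ge h1, sub_self, zero_div]
  have hon : ∀ k : FreqMomentum L M, P k.2 →
      (1 - salmhoferCutoff ((matsubaraFreq β M k.1 ^ 2 + e' k.2 ^ 2) / Λ ^ 2)) / Real.sqrt (matsubaraFreq β M k.1 ^ 2 + e' k.2 ^ 2) =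
        (1 - hubbardCutoffWeightCT L M β μ K Λ k) / Real.sqrt (matsubaraFreq β M k.1 ^ 2 + nambuXiCT L μ K k.2 ^ 2) := by
    intro k hk
    have hek : e' k.2 = nambuXiCT L μ K k.2 := by simp [he', hk]
    rw [hek]; rfl
  have heq : ∑ k ∈ (univ : Finset (FreqMomentum L M)).filter (fun k => P k.2),
        (1 - hubbardCutoffWeightCT L M β μ K Λ k) / Real.sqrt (matsubaraFreq β M k.1 ^ 2 + nambuXiCT L μ K k.2 ^ 2) =
      ∑ k : FreqMomentum L M, (1 - salmhoferCutoff ((matsubaraFreq β M k.1 ^ 2 + e' k.2 ^ 2) / Λ ^ 2)) /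
        Real.sqrt (matsubaraFreq β M k.1 ^ 2 + e' k.2 ^ 2) := by
    rw [sum_filter]
    refine sum_congr rfl fun k _ => ?_
    split_ifs with hk
    · exact (hon k hk).symm
    · exact (hoff k hk).symm
  rw [heq]
  refine sum_one_sub_cutoff_div_sqrt_le_linear hβ e' hΛ hΛβ hβL hc₁ hc₂ fun η hη hηΛ => ?_
  refine le_trans ?_ (hcount η hη hηΛ)
  have hsub : ((univ : Finset (TorusSite 2 L)).filter fun p => |e' p| < η) ⊆
      ((univ : Finset (TorusSite 2 L)).filter fun p => P p ∧ |nambuXiCT L μ K p| < η) := by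
    intro p hp
    rw [mem_filter] at hp ⊢
    refine ⟨mem_univ _, ?_⟩
    by_cases hPp : P p
    · have : e' p = nambuXiCT L μ K p := by simp [he', hPp]
      exact ⟨hPp, by rw [← this]; exact hp.2⟩
    · have : e' p = Λ := by simp [he', hPp]
      rw [this, abs_of_pos hΛ] at hp
      exact absurd hp.2 (not_lt.mpr hηΛ)
  exact_mod_cast card_le_card hsub

end SoftRestricted

/-! ## §3 The lattice two-shell count in linear form, per hard shell -/

section TwoShell

variable {L M : ℕ} [NeZero L]

/-- **Two-shell count, linear form**: with `G = 4 + (8/3)Gfr₁U²`, `δ = 2π/L`, `Y = (ε₂+Gδ)/ρ + √(ε₂+Gδ)`, for `0 < η ≤ ε₂`, `ε₂ + Gδ ≤ klE0`, `0 < ρ ≤ |p_Qm|_𝕋`: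
`#{p : |e_K(p − Qm)| ≤ ε₂ ∧ |e_K(p)| < η} ≤ (9klTS·Y/(4π²))·η·L² + (9klTS·G·Y/(2π))·L`. -/
theorem card_twoShell_filter_le_linear {R : RenConsts} (hR : R.WF2) {U : ℝ} (hU : 0 < U) (hUu : U ≤ klTSU R) {μ : ℝ} (hμ : μ ∈ klWindowC)
    {N : ℕ} {K : TrigPolyC4v} (hK : FrameOK R U N μ K) {ε₂ : ℝ}
    (h2 : ε₂ + (4 + 8 / 3 * R.Gfr 1 * U ^ 2) * (2 * π / L) ≤ klE0) (Qm : TorusSite 2 L) {ρ : ℝ} (hρ : 0 < ρ) (hρQ : ρ ≤ klTorusNorm L Qm)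
    {η : ℝ} (hη : 0 < η) (hηε : η ≤ ε₂) :
    (((univ : Finset (TorusSite 2 L)).filter fun p => |nambuXiCT L μ K (p - Qm)| ≤ ε₂ ∧ |nambuXiCT L μ K p| < η).card : ℝ) ≤
      (9 * klTS * ((ε₂ + (4 + 8 / 3 * R.Gfr 1 * U ^ 2) * (2 * π / L)) / ρ + Real.sqrt (ε₂ + (4 + 8 / 3 * R.Gfr 1 * U ^ 2) * (2 * π / L))) /
          (4 * π ^ 2)) * η * (L : ℝ) ^ 2 +
        (9 * klTS * (4 + 8 / 3 * R.Gfr 1 * U ^ 2) *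
          ((ε₂ + (4 + 8 / 3 * R.Gfr 1 * U ^ 2) * (2 * π / L)) / ρ + Real.sqrt (ε₂ + (4 + 8 / 3 * R.Gfr 1 * U ^ 2) * (2 * π / L))) / (2 * π)) * L := by
  have hπ := Real.pi_pos
  have hL : (0 : ℝ) < L := by exact_mod_cast Nat.pos_of_ne_zero (NeZero.ne L)
  have h := card_twoShell_mul_sq_le_klTS hR hU hUu hμ hK hη hηε h2 Qm hρ hρQ
  -- same set (swap the conjuncts)
  have hset : ((univ : Finset (TorusSite 2 L)).filter fun p => |nambuXiCT L μ K (p - Qm)| ≤ ε₂ ∧ |nambuXiCT L μ K p| < η) =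
      ((univ : Finset (TorusSite 2 L)).filter fun p => |nambuXiCT L μ K p| < η ∧ |nambuXiCT L μ K (p - Qm)| ≤ ε₂) := by
    ext p; simp [and_comm]
  rw [hset]
  have hδ : (2 * π / (L : ℝ)) ^ 2 = 4 * π ^ 2 / (L : ℝ) ^ 2 := by field_simp; ring
  rw [hδ, mul_div_assoc', div_le_iff₀ (by positivity)] at h
  -- `h : card · (4π²) ≤ 9 klTS (η + Gδ) Y · L²`
  have key : (((univ : Finset (TorusSite 2 L)).filter fun p => |nambuXiCT L μ K p| < η ∧ |nambuXiCT L μ K (p - Qm)| ≤ ε₂).card : ℝ) ≤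
      9 * (klTS * (η + (4 + 8 / 3 * R.Gfr 1 * U ^ 2) * (2 * π / L)) *
        ((ε₂ + (4 + 8 / 3 * R.Gfr 1 * U ^ 2) * (2 * π / L)) / ρ + Real.sqrt (ε₂ + (4 + 8 / 3 * R.Gfr 1 * U ^ 2) * (2 * π / L)))) *
          (L : ℝ) ^ 2 / (4 * π ^ 2) := by
    rw [le_div_iff₀ (by positivity)]
    exact h
  refine key.trans (le_of_eq ?_)
  field_simp
  ring

end TwoShell

/-! ## §4 The transfer-weight mass under the envelope (generic reshaping) -/

section Envelope

variable {L M : ℕ} [NeZero L] (β μ : ℝ) (K : TrigPolyC4v)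

/-- **Mass under the envelope**: for `0 < β`, `0 ≤ φ`,
`Σ_p |tₙ[φ](Qm,p)| ≤ (βL²)⁻¹·2·Σ_p klDyadicEnv n (e_K(Qm − p))·(Σ_ν φ(ν,p)‖ĝ(ν,p)‖)` — both rungs' hard partners put under the dyadic envelope
(the first rung after the reindexing `(ν,p) ↦ (−ν, Qm − p)`). -/
theorem sum_abs_klTransferWeight_le_env (hβ : 0 < β) (n : ℕ) {φ : FreqMomentum L M → ℝ} (hφ0 : ∀ k, 0 ≤ φ k) (Qm : TorusSite 2 L) :
    ∑ p, |klTransferWeight L M β μ K n φ Qm p| ≤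
      (β * (L : ℝ) ^ 2)⁻¹ * (2 * ∑ p : TorusSite 2 L, klDyadicEnv n (nambuXiCT L μ K (Qm - p)) *
        ∑ ν : MatsubaraIdx M, φ (ν, p) * ‖propCT L M β μ K (ν, p)‖) := by
  have hc : 0 ≤ (β * (L : ℝ) ^ 2)⁻¹ := by positivity
  set hard : FreqMomentum L M → ℝ := fun k => hubbardCutoffWeightCT L M β μ K (klScale klE0 n) k * ‖propCT L M β μ K k‖ with hhard
  set soft : FreqMomentum L M → ℝ := fun k => φ k * ‖propCT L M β μ K k‖ with hsoft
  set Env : TorusSite 2 L → ℝ := fun p => klDyadicEnv n (nambuXiCT L μ K (Qm - p)) with hEnv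
  have hsoft0 : ∀ k, 0 ≤ soft k := fun k => mul_nonneg (hφ0 k) (norm_nonneg _)
  have hhardEnv : ∀ (ν : MatsubaraIdx M) (p : TorusSite 2 L), hard (ν.rev, Qm - p) ≤ Env p := fun ν p =>
    hardLine_le_klDyadicEnv β μ K n (ν.rev, Qm - p)
  -- termwise
  have hterm : ∀ p, |klTransferWeight L M β μ K n φ Qm p| ≤
      (β * (L : ℝ) ^ 2)⁻¹ * ∑ ν : MatsubaraIdx M, (hard (ν, p) * soft (ν.rev, Qm - p) + soft (ν, p) * hard (ν.rev, Qm - p)) := by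
    intro p
    refine (abs_klTransferWeight_le β μ K hβ n hφ0 Qm p).trans (le_of_eq ?_)
    congr 1
    refine sum_congr rfl fun ν _ => ?_
    simp only [hhard, hsoft]
    ring
  -- reindex the first rung: `Σ_p Σ_ν hard(ν,p)·soft(ν̄,Qm−p) = Σ_p Σ_ν soft(ν,p)·hard(ν̄,Qm−p)`
  have hreindex : ∑ p : TorusSite 2 L, ∑ ν : MatsubaraIdx M, hard (ν, p) * soft (ν.rev, Qm - p) =
      ∑ p : TorusSite 2 L, ∑ ν : MatsubaraIdx M, soft (ν, p) * hard (ν.rev, Qm - p) := by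
    have h1 : ∑ p : TorusSite 2 L, ∑ ν : MatsubaraIdx M, hard (ν, p) * soft (ν.rev, Qm - p) =
        ∑ p : TorusSite 2 L, ∑ ν : MatsubaraIdx M, hard (ν, Qm - p) * soft (ν.rev, p) := by
      refine (Fintype.sum_equiv (Equiv.subLeft Qm) _ _ fun p => ?_).symm
      simp [Equiv.subLeft_apply, sub_sub_cancel]
    rw [h1]
    refine sum_congr rfl fun p _ => ?_
    have h2 : ∑ ν : MatsubaraIdx M, hard (ν, Qm - p) * soft (ν.rev, p) = ∑ ν : MatsubaraIdx M, hard (ν.rev, Qm - p) * soft (ν.rev.rev, p) :=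
      (Equiv.sum_comp Fin.revPerm (fun ν => hard (ν, Qm - p) * soft (ν.rev, p))).symm
    rw [h2]
    refine sum_congr rfl fun ν _ => ?_
    rw [Fin.rev_rev, mul_comm]
  have hB : ∑ p : TorusSite 2 L, ∑ ν : MatsubaraIdx M, soft (ν, p) * hard (ν.rev, Qm - p) ≤
      ∑ p : TorusSite 2 L, Env p * ∑ ν : MatsubaraIdx M, soft (ν, p) := by
    refine sum_le_sum fun p _ => ?_
    rw [mul_sum]
    refine sum_le_sum fun ν _ => ?_
    rw [mul_comm (Env p)]
    exact mul_le_mul_of_nonneg_left (hhardEnv ν p) (hsoft0 _)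
  calc ∑ p, |klTransferWeight L M β μ K n φ Qm p|
      ≤ ∑ p, (β * (L : ℝ) ^ 2)⁻¹ * ∑ ν : MatsubaraIdx M, (hard (ν, p) * soft (ν.rev, Qm - p) + soft (ν, p) * hard (ν.rev, Qm - p)) :=
        sum_le_sum fun p _ => hterm p
    _ = (β * (L : ℝ) ^ 2)⁻¹ * (∑ p, ∑ ν : MatsubaraIdx M, hard (ν, p) * soft (ν.rev, Qm - p) +
          ∑ p, ∑ ν : MatsubaraIdx M, soft (ν, p) * hard (ν.rev, Qm - p)) := by
        rw [← mul_sum, ← sum_add_distrib]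
        congr 1
        exact sum_congr rfl fun p _ => sum_add_distrib
    _ = (β * (L : ℝ) ^ 2)⁻¹ * (2 * ∑ p, ∑ ν : MatsubaraIdx M, soft (ν, p) * hard (ν.rev, Qm - p)) := by rw [hreindex]; ring
    _ ≤ (β * (L : ℝ) ^ 2)⁻¹ * (2 * ∑ p : TorusSite 2 L, Env p * ∑ ν : MatsubaraIdx M, soft (ν, p)) :=
        mul_le_mul_of_nonneg_left (by linarith) hc

/-- **An indicator-weighted slice sum is under the restricted soft sum**: for a momentum predicate `S` and a soft fraction `0 ≤ φ ≤ 1 − w^K_Λ`,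
`Σ_p 𝟙[S p]·Σ_ν φ(ν,p)‖ĝ(ν,p)‖ ≤ Σ_{(ν,p) : S p} (1 − w^K_Λ(ν,p))/√(ω_ν² + e_K(p)²)`. -/
theorem sum_indicator_slice_le_softSum {Λ : ℝ} {φ : FreqMomentum L M → ℝ}
    (hφ : ∀ k, 0 ≤ φ k ∧ φ k ≤ 1 - hubbardCutoffWeightCT L M β μ K Λ k) (S : TorusSite 2 L → Prop) [DecidablePred S] :
    ∑ p : TorusSite 2 L, (if S p then (1 : ℝ) else 0) * ∑ ν : MatsubaraIdx M, φ (ν, p) * ‖propCT L M β μ K (ν, p)‖ ≤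
      ∑ k ∈ (univ : Finset (FreqMomentum L M)).filter (fun k => S k.2),
        (1 - hubbardCutoffWeightCT L M β μ K Λ k) / Real.sqrt (matsubaraFreq β M k.1 ^ 2 + nambuXiCT L μ K k.2 ^ 2) := by
  classical
  set f : FreqMomentum L M → ℝ := fun k =>
    (1 - hubbardCutoffWeightCT L M β μ K Λ k) / Real.sqrt (matsubaraFreq β M k.1 ^ 2 + nambuXiCT L μ K k.2 ^ 2) with hf
  have hsoft_le : ∀ k, φ k * ‖propCT L M β μ K k‖ ≤ f k := fun k => softSymbol_mul_norm_propCT_le β μ K hφ k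
  have hf0 : ∀ k, 0 ≤ f k := fun k => le_trans (mul_nonneg (hφ k).1 (norm_nonneg _)) (hsoft_le k)
  -- rewrite the filtered sum as an indicator sum over the product type
  rw [sum_filter]
  rw [← Finset.univ_product_univ, Finset.sum_product_right]
  refine sum_le_sum fun p _ => ?_
  split_ifs with hS
  · rw [one_mul]
    exact sum_le_sum fun ν _ => hsoft_le (ν, p)
  · rw [zero_mul]
    exact le_of_eq (by simp)

/-- **The envelope sum, expanded**: `Σ_p Env(p)·σ(p) = Σ_{j ≤ n} (4/Λ_j)·Σ_p 𝟙[|e_K(Qm−p)| ≤ Λ_j]·σ(p) + 32·Σ_p σ(p)`. -/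
theorem sum_klDyadicEnv_mul_eq (n : ℕ) (Qm : TorusSite 2 L) (σ : TorusSite 2 L → ℝ) :
    ∑ p : TorusSite 2 L, klDyadicEnv n (nambuXiCT L μ K (Qm - p)) * σ p =
      ∑ j ∈ range (n + 1), (4 / klScale klE0 j) *
          ∑ p : TorusSite 2 L, (if |nambuXiCT L μ K (p - Qm)| ≤ klScale klE0 j then (1 : ℝ) else 0) * σ p +
        32 * ∑ p : TorusSite 2 L, σ p := by
  have heven : ∀ p : TorusSite 2 L, nambuXiCT L μ K (Qm - p) = nambuXiCT L μ K (p - Qm) := fun p => by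
    rw [← neg_sub, nambuXiCT_neg]
  unfold klDyadicEnv
  simp_rw [heven, add_mul, sum_add_distrib, sum_mul, mul_sum]
  congr 1
  rw [sum_comm]
  refine sum_congr rfl fun j _ => sum_congr rfl fun p _ => ?_
  ring

end Envelope

end Summit.HubbardSuperconductivity.HubbardSuperconductivity.Theorems.KLRegimeSplit

end
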